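import Literature.Computability.AlgebraicComplexity.BorderHittingSetsExist
import Literature.Computability.AlgebraicComplexity.DDS21BorderDepthThree
import HarnessLib

/-!
# Dutta–Dwivedi–Saxena 2021, Thms. 4.1, 4.3, 4.4 AS TYPED (existence of small hitting sets for the
# border of `Σ^{[k]}ΠΣ` and `Σ∧Σ`) — discharged by the Heintz–Schnorr existence theorem

Topic: `Literature/Computability/AlgebraicComplexity` (theorem-only; discharges the named facts
`DDS2021_thm_4_1`, `DDS2021_thm_4_3`, `DDS2021_thm_4_4` of `DDS21BorderDepthThree.lean`).

HONEST FRAMING (lead-np RULINGS (84)(a)/(85)(f), val-lit 2026-08-27). The three facts are typed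
"WEAKER than print (explicitness dropped)": they assert the EXISTENCE of a hitting set of the
printed SIZE for the border classes `\overline{Σ^{[k]}ΠΣ}` (Thm. 4.1 = Thm. 1.2, Thm. 4.4 = Thm. 1.3)
and log-variate `\overline{Σ∧Σ}` (Thm. 4.3), whereas the printed theorems give EXPLICIT
(`T(s)`-time constructible) hitting sets, obtained from the DiDIL de-bordering (Thm. 3.2) and known
ABP/ROABP hitting sets. As typed, they are instances of the 1980 existence theorem of Heintz and
Schnorr [HS80, Thm. 4.4] for the Zariski closure of any polynomially parametrised class (here
`Literature.Computability.AlgebraicComplexity.BorderHittingSets.exists_hittingSet_border`, the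
CKRST20 §3.1 rewording): each border class below is given by a generic member with `poly(s)`
indeterminate coefficients, so a hitting set with `poly(s) + 1` points exists — far inside the
typed bounds `s^{c·k·7^k·(log log s + 1)}`, `s^c`, `s^{c·k·7^k}`. THIS PROOF IS EXISTENCE-FORM:
DDS's explicit constructions, their running time and their bit complexity are NOT captured (the
tree has no cost model for points of `F^n`), and the de-bordering theorems `DDS2021_thm_3_2` /
`DDS2021_thm_5_1` are untouched. Nothing here bears on VP versus VNP, which is NOT proved.

## What is proved

* Generic members: `DDS21PIT.spsGeneric` (`Σ^{[k]}Π^{[d]}Σ`, one piece per `d ≤ s`, parameters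
  `Fin k × Fin s × Option (Fin n)`), `DDS21PIT.swsGeneric` (`Σ∧Σ` with all powers `≤ s` carrying
  their own coefficients, one piece per top fan-in `t ≤ s`, parameters
  `(Fin s × Fin (s+1)) ⊕ (Fin s × Option (Fin n))`), with the membership lemmas
  `isMember_spsGeneric_of_isSPS`, `isMember_swsGeneric_of_mem_swsClass`.
* `DDS2021_thm_4_1_holds` (`c = 4`), `DDS2021_thm_4_4_holds` (`c = C + 5`),
  `DDS2021_thm_4_3_holds` (`c = C + 5`).

## References

* [DuttaDwivediSaxena2022] P. Dutta, P. Dwivedi, N. Saxena, *Demystifying the border of depth-3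
  algebraic circuits*, FOCS 2021; full version `paper:galaxy-pdf-7641649743695546420`: Thm. 4.1
  (p0037 L974–976), Thm. 4.3 (p0041 L1098–1099), Thm. 4.4 (p0043 L1131–1132), Def. 2.1
  (p0016 L416–419).
* [HeintzSchnorr1980] J. Heintz, C.-P. Schnorr, *Testing polynomials which are easy to compute*,
  STOC 1980, Thm. 4.4; reworded in [ChatterjeeKumarRamyaSaptharishiTengse2020] arXiv v4 §3.1
  Thms. 3.2–3.3 (held text HOME/lit/pdftxt/CKRST2020 p025–p027), and in P. Bürgisser's 2024
  survey (arXiv:2406.06217, §6 after Def. 6.5, p. 34 L10–14: "The proof in [HS82] relies on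
  bounding the dimension and degree of the affine variety `𝒞̄(n,d,s)` … This even provides hitting
  set generators for `𝒞̄(n,d,s)`").
-/

noncomputable section

open MvPolynomial
open scoped BigOperators

namespace Literature.Computability.AlgebraicComplexity

namespace DDS21PIT

open BorderHittingSets DDS2021 HittingSets

variable {F : Type} [Field F]

/-! ## Padding finite index ranges -/

/-- Extend `α : Fin d → β` to `Fin s` by a default value. [folklore] -/
def padFin {β : Type*} {d s : ℕ} (α : Fin d → β) (z : β) (j' : Fin s) : β :=
  if h : (j' : ℕ) < d then α ⟨j', h⟩ else z

/-- `padFin` agrees with `α` on the embedded range. [folklore] -/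
private theorem padFin_castLE {β : Type*} {d s : ℕ} (hd : d ≤ s) (α : Fin d → β) (z : β)
    (j : Fin d) : padFin α z (Fin.castLE hd j) = α j := by
  simp [padFin, j.2]

/-! ## `Σ^{[k]}Π^{[d]}Σ`: the generic member -/

section SPS

variable (F)

/-- Parameter index of the `Σ^{[k]}Π^{[≤ s]}Σ` generic members: the coefficient `α_{i,j,o}` of the
`j`-th affine form of the `i`-th product (`o = none`: constant term; `o = some m`: of `x_m`), as in
`MS2021.IsSPS` / DDS §1.1 "`f = Σ_{i∈[k]} Π_{j∈[d]} ℓ_{ij}`". [cite: DuttaDwivediSaxena2022, §1.1 (full version p0006, L120–121)] -/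
abbrev SpsIdx (n k s : ℕ) : Type := Fin k × Fin s × Option (Fin n)

/-- The generic `Σ^{[k]}Π^{[d]}Σ` member with `d = jd ≤ s` factors:
`Σ_{i<k} Π_{j<d} (α_{i,j,none} + Σ_m α_{i,j,some m}·x_m)` with indeterminate `α`.
[cite: DuttaDwivediSaxena2022, §1.1 (full version p0006, L120–121)] -/
def spsGeneric (n k s : ℕ) (jd : Fin (s + 1)) :
    MvPolynomial (Fin n) (MvPolynomial (SpsIdx n k s) F) :=
  ∑ i : Fin k, ∏ j : Fin (jd : ℕ),
    (C (X (i, Fin.castLE (Nat.lt_succ_iff.mp jd.2) j, none)) +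
      ∑ m : Fin n, C (X (i, Fin.castLE (Nat.lt_succ_iff.mp jd.2) j, some m)) * X m)

variable {F}

/-- A `Σ^{[k]}Π^{[d]}Σ` polynomial over `F(ε)` with `d ≤ s` is a member of the generic family
(piece `d`; parameters padded by `0`). [cite: DuttaDwivediSaxena2022, §1.1 (full version p0006, L120–121)] -/
theorem isMember_spsGeneric_of_isSPS {n k s d : ℕ} (hd : d ≤ s)
    {g : MvPolynomial (Fin n) (RatFunc F)} (hg : MS2021.IsSPS k d g) :
    IsMember (spsGeneric F n k s) (RatFunc F) g := by
  obtain ⟨α, rfl⟩ := hg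
  refine ⟨⟨d, Nat.lt_succ_of_le hd⟩, fun p => padFin (fun j => α p.1 j p.2.2) 0 p.2.1, ?_⟩
  simp only [spsGeneric, map_sum, map_prod, map_add, map_mul, map_C, map_X, AlgHom.toRingHom_eq_coe,
    RingHom.coe_coe, aeval_X, padFin_castLE hd]

end SPS

/-! ## `Σ∧Σ`: the generic member (all powers `≤ s`, one coefficient each) -/

section SWS

variable (F)

/-- Parameter index of the `Σ∧Σ` generic members: `inl (i, l)` the coefficient of the `l`-th power
of the `i`-th affine form, `inr (i, o)` the coefficients of that form (DDS §2.3
"`f = Σ_i c_i ℓ_i^{e_i}`"). [cite: DuttaDwivediSaxena2022, §2.3 (full version p0020, L537–540)] -/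
abbrev SwsIdx (n s : ℕ) : Type := (Fin s × Fin (s + 1)) ⊕ (Fin s × Option (Fin n))

/-- The generic `Σ∧Σ` member with top fan-in `t = jt ≤ s` and every power `≤ s` present:
`Σ_{i<t} Σ_{l≤s} c_{i,l} · (α_{i,none} + Σ_m α_{i,some m} x_m)^l`.
[cite: DuttaDwivediSaxena2022, §2.3 (full version p0020, L537–540)] -/
def swsGeneric (n s : ℕ) (jt : Fin (s + 1)) :
    MvPolynomial (Fin n) (MvPolynomial (SwsIdx n s) F) :=
  ∑ i : Fin (jt : ℕ), ∑ l : Fin (s + 1),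
    C (X (Sum.inl (Fin.castLE (Nat.lt_succ_iff.mp jt.2) i, l))) *
      (C (X (Sum.inr (Fin.castLE (Nat.lt_succ_iff.mp jt.2) i, none))) +
        ∑ m : Fin n, C (X (Sum.inr (Fin.castLE (Nat.lt_succ_iff.mp jt.2) i, some m))) * X m) ^
          (l : ℕ)

variable {F}

/-- Selecting one power: `Σ_{l ≤ s} [l = e]·a · P^l = a · P^e` (`e ≤ s`). [folklore] -/
private theorem sum_C_ite_mul_pow {R σ : Type*} [CommSemiring R] {s e : ℕ} (he : e < s + 1) (a : R)
    (P : MvPolynomial σ R) :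
    ∑ l : Fin (s + 1), C (if (l : ℕ) = e then a else 0) * P ^ (l : ℕ) = C a * P ^ e := by
  rw [Finset.sum_eq_single ⟨e, he⟩]
  · simp
  · intro l _ hl
    rw [if_neg (fun h => hl (Fin.ext h)), C_0, zero_mul]
  · intro h; exact absurd (Finset.mem_univ _) h

/-- A `Σ∧Σ` polynomial over `F(ε)` with top fan-in `t ≤ s` and exponents `≤ e ≤ s` is a member of
the generic family (piece `t`; `c_{i,l} = c_i` for `l = e_i`, `0` otherwise).
[cite: DuttaDwivediSaxena2022, §2.3 (full version p0020, L537–540)] -/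
theorem isMember_swsGeneric_of_mem_swsClass {n s t e : ℕ} (ht : t ≤ s) (he : e ≤ s)
    {g : MvPolynomial (Fin n) (RatFunc F)} (hg : g ∈ swsClass (RatFunc F) n t e) :
    IsMember (swsGeneric F n s) (RatFunc F) g := by
  classical
  obtain ⟨c, α, ex, hex, rfl⟩ := hg
  refine ⟨⟨t, Nat.lt_succ_of_le ht⟩,
    Sum.elim (fun p => padFin (fun i => if (p.2 : ℕ) = ex i then c i else 0) 0 p.1)
      (fun p => padFin (fun i => α i p.2) 0 p.1), ?_⟩
  simp only [swsGeneric, map_sum, map_mul, map_pow, map_add, map_C, map_X,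
    AlgHom.toRingHom_eq_coe, RingHom.coe_coe, aeval_X, Sum.elim_inl, Sum.elim_inr,
    padFin_castLE ht]
  refine Finset.sum_congr rfl fun i _ => ?_
  rw [sum_C_ite_mul_pow (Nat.lt_succ_of_le ((hex i).trans he))]

end SWS

/-! ## Arithmetic of the size bounds -/

/-- `A · s^b ≤ s^{A+b}` for `s ≥ 2`. [folklore] -/
private theorem mul_pow_le_pow_add {s : ℕ} (hs : 2 ≤ s) (A b : ℕ) : A * s ^ b ≤ s ^ (A + b) := by
  rw [pow_add]
  refine Nat.mul_le_mul_right _ ?_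
  calc A ≤ 2 ^ A := Nat.lt_two_pow_self.le
    _ ≤ s ^ A := Nat.pow_le_pow_left hs A

/-- The parameter count of `Σ^{[k]}Π^{[≤ s]}Σ`: `k·s·(n+1) + 1 ≤ s^4` (`k, n ≤ s`, `s ≥ 2`).
[folklore] -/
private theorem sps_count_le {n k s : ℕ} (hk : k ≤ s) (hn : n ≤ s) (hs : 2 ≤ s) :
    k * (s * (n + 1)) + 1 ≤ s ^ 4 := by
  have h1 : k * (s * (n + 1)) ≤ s * (s * (s + 1)) := by gcongr
  have h3 : 2 * (s * s) ≤ s * (s * s) := Nat.mul_le_mul_right _ hs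
  have h4 : 2 * (s * (s * s)) ≤ s * (s * (s * s)) := Nat.mul_le_mul_right _ hs
  have h5 : 4 ≤ s * s := Nat.mul_le_mul hs hs
  have h2 : s * (s * (s + 1)) + 1 ≤ s ^ 4 := by
    calc s * (s * (s + 1)) + 1 = s * (s * s) + (s * s + 1) := by ring
      _ ≤ s * (s * s) + s * (s * s) := by omega
      _ = 2 * (s * (s * s)) := by ring
      _ ≤ s * (s * (s * s)) := h4
      _ = s ^ 4 := by ring
  omega

end DDS21PIT

open BorderHittingSets DDS2021 HittingSets DDS21PIT

/-! ## The discharges -/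

/-- **DDS Thm. 4.1 (= Thm. 1.2) AS TYPED — hitting set for `\overline{Σ^{[k]}ΠΣ}`, existence form.**
Typed weaker than print (explicitness dropped); this proof is existence-form: an instance of the
Heintz–Schnorr existence theorem [HS80, Thm. 4.4] / [CKRST20, §3.1 Thm. 3.3] for the border of the
polynomially parametrised class `Σ^{[k]}Π^{[≤ s]}Σ` (`BorderHittingSets.exists_hittingSet_border`,
`k·s·(n+1) + 1 ≤ s^4` points; `c = 4`). DDS's explicit `s^{O(k·7^k·log log s)}`-time construction
(via the DiDIL de-bordering Thm. 3.2 and ABP hitting sets) is NOT captured — no cost model.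
[cite: DuttaDwivediSaxena2022, Thm. 4.1 (full version p0037, L974–976)] -/
theorem DDS2021_thm_4_1_holds : DDS2021_thm_4_1 := by
  refine ⟨4, fun F _ _ n k s hk hks hns hs => ?_⟩
  obtain ⟨H, hcard, hH⟩ := exists_hittingSet_border (K := F) (spsGeneric F n k s)
  refine ⟨H, ?_, ?_⟩
  · calc H.card ≤ Fintype.card (SpsIdx n k s) + 1 := hcard
      _ = k * (s * (n + 1)) + 1 := by
          simp [Fintype.card_prod, Fintype.card_fin, Fintype.card_option]
      _ ≤ s ^ 4 := sps_count_le hks hns hs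
      _ ≤ s ^ (4 * k * 7 ^ k * (Nat.log 2 (Nat.log 2 s) + 1)) := by
          refine Nat.pow_le_pow_right (by omega) ?_
          have h7 : 0 < 7 ^ k := by positivity
          have hpos : 0 < k * 7 ^ k * (Nat.log 2 (Nat.log 2 s) + 1) := by positivity
          calc 4 ≤ 4 * (k * 7 ^ k * (Nat.log 2 (Nat.log 2 s) + 1)) := Nat.le_mul_of_pos_right _ hpos
            _ = 4 * k * 7 ^ k * (Nat.log 2 (Nat.log 2 s) + 1) := by ring
  · intro f hf hf0
    obtain ⟨d, hd, g, hg, hfg⟩ := hf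
    exact hH f hf0 ⟨g, isMember_spsGeneric_of_isSPS hd hg, hfg⟩

/-- **DDS Thm. 4.4 (= Thm. 1.3) AS TYPED — hitting set for log-variate `\overline{Σ^{[k]}ΠΣ}`,
existence form.** Typed weaker than print (explicitness dropped); this proof is existence-form
([HS80, Thm. 4.4] / [CKRST20, §3.1] via `BorderHittingSets.exists_hittingSet_border`:
`k·s·(n+1) + 1 ≤ (C+2)·s³ ≤ s^{C+5}` points for `n ≤ C·log₂ s`; `c = C + 5`). DDS's explicit
`s^{O(k7^k)}`-time construction is NOT captured — no cost model.
[cite: DuttaDwivediSaxena2022, Thm. 4.4 (full version p0043, L1131–1132)] -/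
theorem DDS2021_thm_4_4_holds : DDS2021_thm_4_4 := by
  intro C
  refine ⟨C + 5, fun F _ _ n k s hk hks hs hn => ?_⟩
  obtain ⟨H, hcard, hH⟩ := exists_hittingSet_border (K := F) (spsGeneric F n k s)
  refine ⟨H, ?_, ?_⟩
  · have hlog : Nat.log 2 s ≤ s := Nat.log_le_self 2 s
    have hn' : n ≤ C * s := hn.trans (Nat.mul_le_mul_left _ hlog)
    calc H.card ≤ Fintype.card (SpsIdx n k s) + 1 := hcard
      _ = k * (s * (n + 1)) + 1 := by
          simp [Fintype.card_prod, Fintype.card_fin, Fintype.card_option]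
      _ ≤ s * (s * (C * s + 1)) + 1 := by gcongr
      _ ≤ (C + 2) * s ^ 3 := by
          have h3 : 2 * (s * s) ≤ s * (s * s) := Nat.mul_le_mul_right _ hs
          have h5 : 4 ≤ s * s := Nat.mul_le_mul hs hs
          calc s * (s * (C * s + 1)) + 1 = C * s ^ 3 + (s * s + 1) := by ring
            _ ≤ C * s ^ 3 + 2 * s ^ 3 := by
                have : s * s + 1 ≤ 2 * s ^ 3 := by
                  calc s * s + 1 ≤ 2 * (s * s) := by omega
                    _ ≤ s * (s * s) := h3
                    _ ≤ 2 * (s * (s * s)) := Nat.le_mul_of_pos_left _ (by norm_num)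
                    _ = 2 * s ^ 3 := by ring
                omega
            _ = (C + 2) * s ^ 3 := by ring
      _ ≤ s ^ (C + 2 + 3) := mul_pow_le_pow_add hs _ _
      _ ≤ s ^ ((C + 5) * k * 7 ^ k) := by
          refine Nat.pow_le_pow_right (by omega) ?_
          have h7 : 0 < 7 ^ k := by positivity
          have hpos : 0 < k * 7 ^ k := by positivity
          calc C + 2 + 3 = C + 5 := by ring
            _ ≤ (C + 5) * (k * 7 ^ k) := Nat.le_mul_of_pos_right _ hpos
            _ = (C + 5) * k * 7 ^ k := by ring
  · intro f hf hf0
    obtain ⟨d, hd, g, hg, hfg⟩ := hf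
    exact hH f hf0 ⟨g, isMember_spsGeneric_of_isSPS hd hg, hfg⟩

/-- **DDS Thm. 4.3 AS TYPED — hitting set for log-variate `\overline{Σ∧Σ}`, existence form.**
Typed weaker than print (explicitness dropped); this proof is existence-form ([HS80, Thm. 4.4] /
[CKRST20, §3.1] via `BorderHittingSets.exists_hittingSet_border` for the border of `Σ∧Σ` within
budget `s`: `s(s+1) + s(n+1) + 1 ≤ (C+3)·s² ≤ s^{C+5}` points for `n ≤ C·log₂ s`; `c = C + 5`).
DDS's explicit `poly(s)`-time construction is NOT captured — no cost model.
[cite: DuttaDwivediSaxena2022, Thm. 4.3 (full version p0041, L1098–1099)] -/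
theorem DDS2021_thm_4_3_holds : DDS2021_thm_4_3 := by
  intro C
  refine ⟨C + 5, fun F _ _ n s hs hn => ?_⟩
  obtain ⟨H, hcard, hH⟩ := exists_hittingSet_border (K := F) (swsGeneric F n s)
  refine ⟨H, ?_, ?_⟩
  · have hlog : Nat.log 2 s ≤ s := Nat.log_le_self 2 s
    have hn' : n ≤ C * s := hn.trans (Nat.mul_le_mul_left _ hlog)
    calc H.card ≤ Fintype.card (SwsIdx n s) + 1 := hcard
      _ = s * (s + 1) + s * (n + 1) + 1 := by
          simp [Fintype.card_sum, Fintype.card_prod, Fintype.card_fin, Fintype.card_option]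
      _ ≤ s * (s + 1) + s * (C * s + 1) + 1 := by gcongr
      _ ≤ (C + 3) * s ^ 2 := by
          have h5 : 4 ≤ s * s := Nat.mul_le_mul hs hs
          calc s * (s + 1) + s * (C * s + 1) + 1 = (C + 1) * (s * s) + (2 * s + 1) := by ring
            _ ≤ (C + 1) * (s * s) + 2 * (s * s) := by nlinarith
            _ = (C + 3) * s ^ 2 := by ring
      _ ≤ s ^ (C + 3 + 2) := mul_pow_le_pow_add hs _ _
      _ = s ^ (C + 5) := by ring_nf
  · intro f hf hf0
    obtain ⟨t, e, ht, he, g, hg, hfg⟩ := hf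
    exact hH f hf0 ⟨g, isMember_swsGeneric_of_mem_swsClass ht he hg, hfg⟩

end Literature.Computability.AlgebraicComplexity

end
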